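import Summits.RiemannHypothesis.RiemannHypothesis.Theses.UniversalFactor
import Summits.RiemannHypothesis.RiemannHypothesis.Theorems.UniversalFactorLaguerreLift
import Summits.RiemannHypothesis.RiemannHypothesis.Theorems.UniversalFactorLaplaceLoopholeWideTail
import Literature.Analysis.Complex.LaguerrePolya
import Literature.Analysis.Complex.LogDerivZeros
import Mathlib.Topology.Algebra.Module.Cardinality

/-!
# RiemannHypothesis / UniversalFactor — wide kernels: `WideKernelTail → WideKernelNoGo`

Route `RiemannHypothesis/UniversalFactor`, item stmt-RiemannHypothesis-2578 (`WideKernelNoGo`, the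
wide window `0 < a < π/8` of the generalised-Newman kill path of the target `LaplaceLoophole`).
With `Φ = deBruijnPhi`, `H_0 = deBruijnH 0` and the Laplace-smoothed transform
`F_a(z) = ∫₀^∞ Φ(u)(1 + u²/a²)⁻¹ cos(zu) du = deBruijnHDiv (fun u ↦ 1 + u²/a²) z` we prove,
sorry-free:

* `UniversalFactor.exists_zeroFree_factor` — an entire `f` with `f(0) ≠ 0` and all zeros in
  `‖z‖ < R` factors as `f = P · G`, `P(z) = ∏_{a ∈ S}(z − a)^{m(a)}`, `G` entire and zero-free on
  `ℂ` (the tree's `exists_finset_zeros_eq_prod_mul`, glued with `f/P` outside the ball);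
  `UniversalFactor.im_factor_ofReal_eq_zero`, `UniversalFactor.exists_growth_factor`: `G` inherits
  reality on `ℝ` and the growth `‖·‖ ≤ C e^{‖z‖^ρ}`; `UniversalFactor.norm_prod_pow_sub_le_pow`.
* `UniversalFactor.exists_exp_le_re_deBruijnHDiv_laplace_I` — on the imaginary axis
  `F_a(iy) ≥ κ e^{y}` (`y ≥ 0`, some `κ > 0`), because `F_a(iy) = ∫₀^∞ Φ(u)(1+u²/a²)⁻¹cosh(yu) du`
  and `Φ > 0`: `F_a` is not of exponential type.
* `UniversalFactor.false_of_exp_le_pow` — `κ e^{y} ≤ K (y + R)^N` for all `y ≥ 0` is absurd.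
* **`UniversalFactor.wideKernelNoGo_of_wideKernelTail : WideKernelTail → WideKernelNoGo`.** If
  `0 < a < π/8`, `∫₀^∞ H_0(x)cosh(ax)dx ≠ 0` and all zeros of `F_a` were real, the tail
  `e^{ax}F_a(x) → a∫₀^∞ H_0 cosh(a·) ≠ 0` (item `WideKernelTail`, stmt-RiemannHypothesis-2581) and
  evenness put them in a bounded real interval, hence (isolated zeros) there are finitely many;
  dividing them out leaves a zero-free real entire `G` of order `< 2`, and for such `G` the tree's
  Hadamard-free Laguerre–Pólya lemma `norm_vertical_eq_of_forall_ne_zero` gives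
  `‖G(iy)‖ = ‖G(0)‖`, so `‖F_a(iy)‖ ≤ ‖G(0)‖ (y + R)^N` — contradicting `F_a(iy) ≥ κ e^{y}`.

* **`UniversalFactor.wideKernelNoGo : WideKernelNoGo`** (unconditional, closes the item), by the
  tree's `wideKernelTail` (`UniversalFactorLaplaceLoopholeWideTail.lean`, dominated convergence in the
  convolution formula `F_a = H_0 ∗ (a/2)e^{−a|·|}`).

References: N. G. de Bruijn, Duke Math. J. 17 (1950), Thm. 10 (order `< 2`); E. C. Titchmarsh,
*The theory of the Riemann zeta-function* (1986), §3.9 Lemma α (behind `LaguerrePolya.lean`);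
D. A. Cardon, Proc. AMS 130 (2002), §3 Q. 7 (the loophole).
-/

noncomputable section

namespace Summit.RiemannHypothesis.RiemannHypothesis.Theorems

open MeasureTheory Set Filter Metric Complex
open scoped Topology
open Literature.NumberTheory.LFunctions Literature.Analysis.Complex
open Summit.RiemannHypothesis.RiemannHypothesis.Theses

/-! ## Dividing an entire function by all of its (finitely many) zeros -/

/-- **Global extraction of finitely many zeros.** If `f` is entire, `f(0) ≠ 0` and every zero of
`f` lies in the open ball `‖z‖ < R`, then `f = P · G` with `P(z) = ∏_{a ∈ S} (z − a)^{m(a)}` a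
polynomial whose roots are zeros of `f`, and `G` entire and zero-free on all of `ℂ`.
(The tree's `exists_finset_zeros_eq_prod_mul` — Mathlib's `MeromorphicOn.extract_zeros_poles` — on
the ball, glued with `f/P` outside it.) [folklore] -/
theorem UniversalFactor.exists_zeroFree_factor {f : ℂ → ℂ} (hf : Differentiable ℂ f)
    (h0 : f 0 ≠ 0) {R : ℝ} (hR : ∀ z, f z = 0 → ‖z‖ < R) :
    ∃ (S : Finset ℂ) (m : ℂ → ℕ) (G : ℂ → ℂ),
      (∀ a ∈ S, f a = 0 ∧ ‖a‖ < R) ∧ Differentiable ℂ G ∧ (∀ z, G z ≠ 0) ∧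
      ∀ z, f z = (∏ a ∈ S, (z - a) ^ m a) * G z := by
  obtain ⟨S, m, g, hS, hS', hgd, hg0, hfg⟩ := exists_finset_zeros_eq_prod_mul hf (c := 0) h0 R
  classical
  set P : ℂ → ℂ := fun z ↦ ∏ a ∈ S, (z - a) ^ m a with hP
  set G : ℂ → ℂ := fun z ↦ if ‖z‖ < R then g z else f z / P z with hG
  have hball : ∀ z : ℂ, z ∈ ball (0 : ℂ) R ↔ ‖z‖ < R := fun z ↦ by
    rw [mem_ball, dist_zero_right]
  have hSball : ∀ a ∈ S, ‖a‖ < R := fun a ha ↦ (hball a).1 (hS a ha).2.2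
  -- `P ≠ 0` off `S`
  have hPne : ∀ z, z ∉ S → P z ≠ 0 := fun z hz ↦
    prod_pow_sub_ne_zero m fun a ha h ↦ hz (h ▸ ha)
  -- off `S`, `G = f / P`
  have hGeq : ∀ z, z ∉ S → G z = f z / P z := by
    intro z hz
    by_cases hzR : ‖z‖ < R
    · have h1 : G z = g z := by simp [hG, hzR]
      rw [h1, eq_div_iff (hPne z hz), hfg z ((hball z).2 hzR)]
      simp only [hP]
      ring
    · simp [hG, hzR]
  -- inside the ball, `G = g`
  have hGin : ∀ z, ‖z‖ < R → G z = g z := fun z hz ↦ by simp [hG, hz]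
  refine ⟨S, m, G, fun a ha ↦ ⟨(hS a ha).1, hSball a ha⟩, ?_, ?_, ?_⟩
  · -- differentiability
    intro z
    by_cases hzR : ‖z‖ < R
    · have hz : z ∈ ball (0 : ℂ) R := (hball z).2 hzR
      have hev : G =ᶠ[𝓝 z] g := by
        filter_upwards [isOpen_ball.mem_nhds hz] with w hw
        exact hGin w ((hball w).1 hw)
      exact (hev.differentiableAt_iff).2 (hgd.differentiableAt (isOpen_ball.mem_nhds hz))
    · have hzS : z ∉ S := fun h ↦ hzR (hSball z h)
      have hopen : IsOpen ((S : Set ℂ)ᶜ) := S.finite_toSet.isClosed.isOpen_compl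
      have hev : G =ᶠ[𝓝 z] fun w ↦ f w / P w := by
        filter_upwards [hopen.mem_nhds (show z ∈ ((S : Set ℂ)ᶜ) from hzS)] with w hw
        exact hGeq w hw
      refine (hev.differentiableAt_iff).2 ?_
      exact ((hf z).div ((differentiable_prod_pow_sub S m) z) (hPne z hzS))
  · -- zero-free
    intro z
    by_cases hzR : ‖z‖ < R
    · rw [hGin z hzR]; exact hg0 z ((hball z).2 hzR)
    · have hzS : z ∉ S := fun h ↦ hzR (hSball z h)
      have hfz : f z ≠ 0 := fun h ↦ hzR (hR z h)
      rw [hGeq z hzS]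
      exact div_ne_zero hfz (hPne z hzS)
  · -- the factorisation
    intro z
    by_cases hzR : ‖z‖ < R
    · rw [hGin z hzR]; exact hfg z ((hball z).2 hzR)
    · have hzS : z ∉ S := fun h ↦ hzR (hSball z h)
      have hPz := hPne z hzS
      rw [hGeq z hzS]
      simp only [hP] at hPz ⊢
      field_simp


/-- If `f = P · G` with `P(z) = ∏_{a ∈ S} (z − a)^{m(a)}`, all `a ∈ S` real, `f` real on `ℝ` and `G`
entire, then `G` is real on `ℝ` (off the finite set `S` it is a quotient of reals; on `S` by
continuity and density). [folklore] -/
theorem UniversalFactor.im_factor_ofReal_eq_zero {f G : ℂ → ℂ} {S : Finset ℂ} {m : ℂ → ℕ}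
    (hG : Differentiable ℂ G) (hfac : ∀ z, f z = (∏ a ∈ S, (z - a) ^ m a) * G z)
    (hreal : ∀ x : ℝ, (f x).im = 0) (hS : ∀ a ∈ S, a.im = 0) (x : ℝ) : (G x).im = 0 := by
  classical
  -- the polynomial is real at real points
  have hPreal : ∀ x : ℝ, (∏ a ∈ S, ((x : ℂ) - a) ^ m a) =
      ((∏ a ∈ S, (x - a.re) ^ m a : ℝ) : ℂ) := by
    intro x
    push_cast
    refine Finset.prod_congr rfl fun a ha ↦ ?_
    congr 1
    apply Complex.ext <;> simp [hS a ha]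
  -- off `S`, `G x` is real
  have hoff : ∀ x : ℝ, (x : ℂ) ∉ S → (G x).im = 0 := by
    intro x hx
    have hPne : (∏ a ∈ S, ((x : ℂ) - a) ^ m a) ≠ 0 :=
      prod_pow_sub_ne_zero m fun a ha h ↦ hx (h ▸ ha)
    have hGx : G x = f x / ∏ a ∈ S, ((x : ℂ) - a) ^ m a := by
      rw [hfac x]; field_simp
    have hfx : f x = ((f x).re : ℂ) := Complex.ext (by simp) (by simp [hreal x])
    rw [hGx, hPreal x, hfx, ← Complex.ofReal_div, Complex.ofReal_im]
  -- the exceptional set is finite, so its complement is dense; conclude by continuity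
  set T : Set ℝ := ((↑) : ℝ → ℂ) ⁻¹' (S : Set ℂ) with hT
  have hTfin : T.Finite := S.finite_toSet.preimage Complex.ofReal_injective.injOn
  have hdense : Dense Tᶜ := hTfin.countable.dense_compl ℝ
  have hcont : Continuous fun x : ℝ ↦ (G x).im :=
    Complex.continuous_im.comp (hG.continuous.comp Complex.continuous_ofReal)
  have h := Continuous.ext_on hdense hcont continuous_const fun x hx ↦ hoff x hx
  exact congrFun h x

/-- If `f = P · G` as above with `‖f(z)‖ ≤ C e^{‖z‖^ρ}` and the roots of `P` in `‖a‖ < R`, then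
`‖G(z)‖ ≤ C' e^{‖z‖^ρ}`: far from the roots `‖P‖ ≥ 1`, near them `G` is bounded. [folklore] -/
theorem UniversalFactor.exists_growth_factor {f G : ℂ → ℂ} {S : Finset ℂ} {m : ℂ → ℕ}
    {ρ C R : ℝ} (hG : Differentiable ℂ G) (hfac : ∀ z, f z = (∏ a ∈ S, (z - a) ^ m a) * G z)
    (hgr : ∀ z, ‖f z‖ ≤ C * Real.exp (‖z‖ ^ ρ)) (hS : ∀ a ∈ S, ‖a‖ < R) :
    ∃ C' : ℝ, ∀ z, ‖G z‖ ≤ C' * Real.exp (‖z‖ ^ ρ) := by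
  classical
  obtain ⟨M, hM⟩ := (isCompact_closedBall (0 : ℂ) (R + 1)).exists_bound_of_continuousOn
    hG.continuous.continuousOn
  refine ⟨max C 0 + max M 0, fun z ↦ ?_⟩
  have hexp1 : 1 ≤ Real.exp (‖z‖ ^ ρ) := Real.one_le_exp (Real.rpow_nonneg (norm_nonneg z) ρ)
  rcases le_or_gt ‖z‖ (R + 1) with hz | hz
  · have h1 : ‖G z‖ ≤ M := hM z (mem_closedBall_zero_iff.2 hz)
    calc ‖G z‖ ≤ max M 0 * 1 := by rw [mul_one]; exact h1.trans (le_max_left _ _)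
      _ ≤ (max C 0 + max M 0) * Real.exp (‖z‖ ^ ρ) :=
          mul_le_mul (le_add_of_nonneg_left (le_max_right _ _)) hexp1 zero_le_one (by positivity)
  · have hP1 : 1 ≤ ‖∏ a ∈ S, (z - a) ^ m a‖ := by
      rw [norm_prod]
      refine Finset.prod_induction _ (fun x : ℝ ↦ 1 ≤ x)
        (fun x y hx hy ↦ one_le_mul_of_one_le_of_one_le hx hy) le_rfl fun a ha ↦ ?_
      rw [norm_pow]
      refine one_le_pow₀ ?_
      have h1 : ‖z‖ ≤ ‖z - a‖ + ‖a‖ := norm_le_norm_sub_add z a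
      linarith [hS a ha]
    have h2 : ‖f z‖ = ‖∏ a ∈ S, (z - a) ^ m a‖ * ‖G z‖ := by rw [hfac z, norm_mul]
    calc ‖G z‖ ≤ ‖∏ a ∈ S, (z - a) ^ m a‖ * ‖G z‖ := le_mul_of_one_le_left (norm_nonneg _) hP1
      _ = ‖f z‖ := h2.symm
      _ ≤ C * Real.exp (‖z‖ ^ ρ) := hgr z
      _ ≤ (max C 0 + max M 0) * Real.exp (‖z‖ ^ ρ) := by
          gcongr
          exact (le_max_left _ _).trans (le_add_of_nonneg_right (le_max_right _ _))

/-- `‖∏_{a ∈ S} (z − a)^{m(a)}‖ ≤ (‖z‖ + R)^{∑ m(a)}` when all `‖a‖ < R`. [folklore] -/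
theorem UniversalFactor.norm_prod_pow_sub_le_pow {S : Finset ℂ} (m : ℂ → ℕ) {R : ℝ}
    (hS : ∀ a ∈ S, ‖a‖ < R) (z : ℂ) :
    ‖∏ a ∈ S, (z - a) ^ m a‖ ≤ (‖z‖ + R) ^ (∑ a ∈ S, m a) := by
  classical
  rw [norm_prod, ← Finset.prod_pow_eq_pow_sum]
  refine Finset.prod_le_prod (fun a _ ↦ norm_nonneg _) fun a ha ↦ ?_
  rw [norm_pow]
  refine pow_le_pow_left₀ (norm_nonneg _) ?_ _
  calc ‖z - a‖ ≤ ‖z‖ + ‖a‖ := norm_sub_le _ _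
    _ ≤ ‖z‖ + R := by linarith [hS a ha]

/-! ## The Laplace-smoothed transform on the imaginary axis grows exponentially -/

/-- **`F_a(iy) ≥ κ e^{y}` for `y ≥ 0`**: on the imaginary axis
`F_a(iy) = ∫₀^∞ Φ(u)(1 + u²/a²)⁻¹ cosh(yu) du ≥ (e^{y}/2) ∫₁^∞ Φ(u)(1 + u²/a²)⁻¹ du`, and `Φ > 0`.
(So `F_a` is of order `1` but not of exponential type.) [folklore] -/
theorem UniversalFactor.exists_exp_le_re_deBruijnHDiv_laplace_I (a : ℝ) :
    ∃ κ : ℝ, 0 < κ ∧ ∀ y : ℝ, 0 ≤ y →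
      κ * Real.exp y ≤ (deBruijnHDiv (fun u : ℝ => 1 + u ^ 2 / a ^ 2) (I * y)).re := by
  set m : ℝ → ℝ := fun u ↦ 1 + u ^ 2 / a ^ 2 with hm
  have hadm : IsDivAdmissible m := isDivAdmissible_laplace a
  set w : ℝ → ℝ := fun u ↦ deBruijnPhi u / m u with hw
  have hm_pos : ∀ u, 0 < m u := fun u ↦ by positivity
  have hw_pos : ∀ u, 0 ≤ u → 0 < w u := fun u hu ↦
    div_pos (deBruijnPhi_pos_of_nonneg hu) (hm_pos u)
  have hcosI : ∀ y u : ℝ, ((deBruijnPhi u / m u : ℝ) : ℂ) * Complex.cos (I * y * u) =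
      ((w u * Real.cosh (y * u) : ℝ) : ℂ) := by
    intro y u
    rw [show I * (y : ℂ) * (u : ℂ) = ((y * u : ℝ) : ℂ) * I by push_cast; ring, Complex.cos_mul_I,
      ← Complex.ofReal_cosh, ← Complex.ofReal_mul]
  -- the integrand on the imaginary axis is the real function `w(u) cosh(yu)`
  have hint : ∀ y : ℝ, IntegrableOn (fun u : ℝ ↦ w u * Real.cosh (y * u)) (Ioi 0) := by
    intro y
    have h : IntegrableOn (fun u : ℝ ↦
        RCLike.re (((deBruijnPhi u / m u : ℝ) : ℂ) * Complex.cos (I * y * u))) (Ioi 0) :=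
      (hadm.integrableOn_deBruijnHDiv (I * y)).re
    refine h.congr_fun (fun u _ ↦ ?_) measurableSet_Ioi
    show RCLike.re (((deBruijnPhi u / m u : ℝ) : ℂ) * Complex.cos (I * y * u)) = w u * Real.cosh (y * u)
    rw [hcosI, RCLike.re_to_complex, Complex.ofReal_re]
  have hre : ∀ y : ℝ, (deBruijnHDiv m (I * y)).re = ∫ u in Ioi (0:ℝ), w u * Real.cosh (y * u) := by
    intro y
    rw [deBruijnHDiv]
    simp_rw [hcosI]
    rw [integral_complex_ofReal, Complex.ofReal_re]
  -- the constant
  have hint1 : IntegrableOn w (Ioi 1) := by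
    have h := (hint 0).mono_set (Ioi_subset_Ioi zero_le_one)
    refine h.congr_fun (fun u _ ↦ ?_) measurableSet_Ioi
    simp
  set κ₀ : ℝ := ∫ u in Ioi (1:ℝ), w u with hκ₀
  have hκ₀pos : 0 < κ₀ := by
    rw [hκ₀, setIntegral_pos_iff_support_of_nonneg_ae]
    · have hsub : Ioi (1:ℝ) ⊆ Function.support w ∩ Ioi 1 := fun u hu ↦
        ⟨(hw_pos u (by linarith [mem_Ioi.1 hu])).ne', hu⟩
      refine lt_of_lt_of_le ?_ (measure_mono hsub)
      simp
    · exact ae_restrict_of_forall_mem measurableSet_Ioi fun u hu ↦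
        (hw_pos u (by linarith [mem_Ioi.1 hu])).le
    · exact hint1
  refine ⟨κ₀ / 2, by positivity, fun y hy ↦ ?_⟩
  rw [hre y]
  have h1 : ∫ u in Ioi (1:ℝ), w u * Real.cosh (y * u) ≤ ∫ u in Ioi (0:ℝ), w u * Real.cosh (y * u) :=
    setIntegral_mono_set (hint y)
      (ae_restrict_of_forall_mem measurableSet_Ioi fun u hu ↦
        (mul_pos (hw_pos u (le_of_lt hu)) (Real.cosh_pos _)).le)
      (Ioi_subset_Ioi zero_le_one).eventuallyLE
  have h2 : ∫ u in Ioi (1:ℝ), w u * (Real.exp y / 2) ≤ ∫ u in Ioi (1:ℝ), w u * Real.cosh (y * u) := by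
    refine setIntegral_mono_on (hint1.mul_const _) ((hint y).mono_set (Ioi_subset_Ioi zero_le_one))
      measurableSet_Ioi fun u hu ↦ ?_
    have hu1 : 1 ≤ u := le_of_lt hu
    have hwu : 0 ≤ w u := (hw_pos u (by linarith)).le
    refine mul_le_mul_of_nonneg_left ?_ hwu
    rw [Real.cosh_eq]
    have he : Real.exp y ≤ Real.exp (y * u) := Real.exp_le_exp.2 (by nlinarith)
    have he' : 0 < Real.exp (-(y * u)) := Real.exp_pos _
    linarith
  have h3 : ∫ u in Ioi (1:ℝ), w u * (Real.exp y / 2) = κ₀ * (Real.exp y / 2) := by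
    rw [integral_mul_const]
  calc κ₀ / 2 * Real.exp y = κ₀ * (Real.exp y / 2) := by ring
    _ = ∫ u in Ioi (1:ℝ), w u * (Real.exp y / 2) := h3.symm
    _ ≤ ∫ u in Ioi (1:ℝ), w u * Real.cosh (y * u) := h2
    _ ≤ ∫ u in Ioi (0:ℝ), w u * Real.cosh (y * u) := h1

/-- An exponential lower bound and a polynomial upper bound are incompatible:
`κ e^{y} ≤ K (y + R)^N` for all `y ≥ 0` with `κ > 0` is absurd. [folklore] -/
theorem UniversalFactor.false_of_exp_le_pow {κ K R : ℝ} {N : ℕ} (hκ : 0 < κ)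
    (h : ∀ y : ℝ, 0 ≤ y → κ * Real.exp y ≤ K * (y + R) ^ N) : False := by
  have h1 : Tendsto (fun y : ℝ ↦ (y + R) ^ N * Real.exp (-(y + R))) atTop (𝓝 0) :=
    (Real.tendsto_pow_mul_exp_neg_atTop_nhds_zero N).comp
      (tendsto_atTop_add_const_right _ _ tendsto_id)
  have h2 : Tendsto (fun y : ℝ ↦ K * Real.exp R * ((y + R) ^ N * Real.exp (-(y + R)))) atTop
      (𝓝 (K * Real.exp R * 0)) := h1.const_mul _
  rw [mul_zero] at h2
  obtain ⟨y, hy, hy0⟩ := ((h2.eventually_lt_const hκ).and (eventually_ge_atTop 0)).exists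
  have h3 := h y hy0
  have key : K * Real.exp R * ((y + R) ^ N * Real.exp (-(y + R))) =
      K * (y + R) ^ N * (Real.exp y)⁻¹ := by
    rw [neg_add, Real.exp_add, Real.exp_neg, Real.exp_neg]
    field_simp
  rw [key] at hy
  have h4 : κ ≤ K * (y + R) ^ N * (Real.exp y)⁻¹ := by
    rw [← div_eq_mul_inv, le_div_iff₀ (Real.exp_pos y)]; exact h3
  linarith

/-! ## `WideKernelTail → WideKernelNoGo` -/

/-- **Wide kernels are not Laguerre–Pólya** (route `UniversalFactor`, item stmt-RiemannHypothesis-2578,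
modulo the tail asymptotics `WideKernelTail` of item stmt-RiemannHypothesis-2581): for `0 < a < π/8`
with `∫₀^∞ H_0(x) cosh(ax) dx ≠ 0`, `F_a` has a non-real zero. If all zeros of `F_a` were real:
the tail `e^{ax} F_a(x) → a ∫₀^∞ H_0 cosh(a·) ≠ 0` and evenness confine them to a bounded real
interval, so they are finitely many; dividing them out leaves a zero-free real entire `G` of
order `< 2`, for which `‖G(iy)‖ = ‖G(0)‖` (`norm_vertical_eq_of_forall_ne_zero`, Hadamard-free),
whence `‖F_a(iy)‖` grows at most polynomially — but `F_a(iy) ≥ κ e^{y}` since `Φ > 0`. [folklore] -/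
theorem UniversalFactor.wideKernelNoGo_of_wideKernelTail (hT : UniversalFactor.WideKernelTail) :
    UniversalFactor.WideKernelNoGo := by
  intro a ha haπ hC hZ
  set m : ℝ → ℝ := fun u ↦ 1 + u ^ 2 / a ^ 2 with hm
  set F : ℂ → ℂ := deBruijnHDiv m with hFdef
  have hZ' : ∀ z, F z = 0 → z.im = 0 := fun z hz ↦ hZ z hz
  have hFd : Differentiable ℂ F := differentiable_deBruijnHDiv_laplace a
  have hFreal : ∀ x : ℝ, (F x).im = 0 := fun x ↦ deBruijnHDiv_ofReal_im m x
  have hFeven : ∀ z, F (-z) = F z := fun z ↦ deBruijnHDiv_neg m z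
  obtain ⟨ρ, C, hρ0, hρ, hgr⟩ := UniversalFactor.exists_growth_deBruijnHDiv_laplace a
  -- the tail: `F x ≠ 0` for large real `x`
  have hT' : Tendsto (fun x : ℝ ↦ (Real.exp (a * x) : ℂ) * F x) atTop
      (𝓝 ((a : ℂ) * ∫ y in Set.Ioi (0:ℝ), deBruijnH 0 (y : ℂ) * (Real.cosh (a * y) : ℂ))) :=
    hT a ha haπ
  have hlim : ((a : ℂ) * ∫ y in Set.Ioi (0:ℝ), deBruijnH 0 (y : ℂ) * (Real.cosh (a * y) : ℂ)) ≠ 0 :=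
    mul_ne_zero (by exact_mod_cast ha.ne') hC
  obtain ⟨X, hX⟩ := Filter.eventually_atTop.1 (hT'.eventually_ne hlim)
  have hFne : ∀ x : ℝ, X ≤ x → F x ≠ 0 := fun x hx h ↦ hX x hx (by rw [h, mul_zero])
  -- all zeros of `F` lie in `‖z‖ < R`
  set R : ℝ := max X 0 + 1 with hR
  have hzeros : ∀ z, F z = 0 → ‖z‖ < R := by
    intro z hz
    have him : z.im = 0 := hZ' z hz
    have hzre : z = ((z.re : ℝ) : ℂ) := Complex.ext (by simp) (by simp [him])
    by_contra hge
    push Not at hge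
    have hnorm : ‖z‖ = |z.re| := by rw [hzre, Complex.norm_real, Real.norm_eq_abs, Complex.ofReal_re]
    rw [hnorm] at hge
    rcases le_or_gt 0 z.re with h | h
    · rw [abs_of_nonneg h] at hge
      refine hFne z.re (by linarith [le_max_left X 0]) ?_
      rw [← hzre]; exact hz
    · rw [abs_of_neg h] at hge
      refine hFne (-z.re) (by linarith [le_max_left X 0]) ?_
      rw [Complex.ofReal_neg, hFeven, ← hzre]; exact hz
  -- `F 0 ≠ 0`
  obtain ⟨κ, hκ, hlow⟩ := UniversalFactor.exists_exp_le_re_deBruijnHDiv_laplace_I a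
  have hF0 : F 0 ≠ 0 := by
    intro h
    have h1 := hlow 0 le_rfl
    rw [Complex.ofReal_zero, mul_zero, Real.exp_zero, mul_one] at h1
    have h2 : (deBruijnHDiv (fun u : ℝ => 1 + u ^ 2 / a ^ 2) 0).re = 0 := by
      rw [show deBruijnHDiv (fun u : ℝ => 1 + u ^ 2 / a ^ 2) 0 = F 0 from rfl, h, Complex.zero_re]
    linarith
  -- divide out the zeros
  obtain ⟨S, mult, G, hS, hGd, hG0, hfac⟩ := UniversalFactor.exists_zeroFree_factor hFd hF0 hzeros
  have hSreal : ∀ b ∈ S, b.im = 0 := fun b hb ↦ hZ' b (hS b hb).1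
  have hGreal : ∀ x : ℝ, (G x).im = 0 :=
    UniversalFactor.im_factor_ofReal_eq_zero hGd hfac hFreal hSreal
  obtain ⟨C', hgr'⟩ := UniversalFactor.exists_growth_factor hGd hfac hgr fun b hb ↦ (hS b hb).2
  have hGI : ∀ y : ℝ, ‖G (I * y)‖ = ‖G 0‖ := fun y ↦ by
    have h := norm_vertical_eq_of_forall_ne_zero hGd hρ0 hρ hgr' hGreal hG0 0 y
    simpa using h
  -- polynomial upper bound against exponential lower bound on the imaginary axis
  refine UniversalFactor.false_of_exp_le_pow (K := ‖G 0‖) (R := R) (N := ∑ b ∈ S, mult b) hκ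
    fun y hy ↦ ?_
  have hIy : ‖I * (y : ℂ)‖ = y := by
    rw [norm_mul, Complex.norm_I, one_mul, Complex.norm_real, Real.norm_eq_abs, abs_of_nonneg hy]
  calc κ * Real.exp y ≤ (deBruijnHDiv (fun u : ℝ => 1 + u ^ 2 / a ^ 2) (I * y)).re := hlow y hy
    _ ≤ ‖F (I * y)‖ := Complex.re_le_norm _
    _ = ‖∏ b ∈ S, (I * y - b) ^ mult b‖ * ‖G (I * y)‖ := by rw [hfac, norm_mul]
    _ ≤ (‖I * (y : ℂ)‖ + R) ^ (∑ b ∈ S, mult b) * ‖G 0‖ := by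
        rw [hGI]
        exact mul_le_mul_of_nonneg_right
          (UniversalFactor.norm_prod_pow_sub_le_pow mult (fun b hb ↦ (hS b hb).2) _) (norm_nonneg _)
    _ = ‖G 0‖ * (y + R) ^ (∑ b ∈ S, mult b) := by rw [hIy, mul_comm]


/-- **`WideKernelNoGo`** (route `UniversalFactor`, item stmt-RiemannHypothesis-2578), unconditionally:
for `0 < a < π/8` with `∫₀^∞ H_0(x) cosh(ax) dx ≠ 0`, the Laplace-smoothed transform
`F_a(z) = ∫₀^∞ Φ(u)(1 + u²/a²)⁻¹ cos(zu) du` has a non-real zero — no WIDE Pólya-frequency smoothing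
of `Ξ` is in the Laguerre–Pólya class (generalised Newman in the wide non-exceptional directions).
From `wideKernelNoGo_of_wideKernelTail` and the tree's tail asymptotics `wideKernelTail`. [folklore] -/
theorem UniversalFactor.wideKernelNoGo : UniversalFactor.WideKernelNoGo :=
  UniversalFactor.wideKernelNoGo_of_wideKernelTail wideKernelTail

end Summit.RiemannHypothesis.RiemannHypothesis.Theorems
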